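import Summits.CriticalPhenomena.PercolationContinuityZ3.Theorems.PercNearOneGluingNoHeavyLowerTailAntitheticHandleDual
import Summits.CriticalPhenomena.PercolationContinuityZ3.Theorems.PercNearOneGluingNoHeavyLowerTailAntitheticComparable
import HarnessLib

/-!
# `NoHeavyLowerTail` (stmt-CriticalPhenomena-4575) — antithetic cluster pairs: **THEOREM KnH — a COMPLETE GRAPH PLUS A HANDLE** (CONJECTURE Δ2 /
# the vertex antithetic inequality at `R = {x}` for `K_n + handle(P,Q)`, EVERY `n`, every `Q`, all arm lengths; prim-hp-2 gen 64,
# HOME/MEMO-gen64.md §3bis)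

Support file (`--supports stmt-CriticalPhenomena-4575`, hull-port prover `prim-hp-2`, gen 64).  No definitions, no named facts, no sorries;
standard axioms — NO certificate: the first INFINITE family of handle theorems whose core is not box-decomposable at either end
(`λ(s,P) = λ(s,Q) = n − 1`).

THE GRAPH.  `W` a set of vertices containing the source `s`; `E₀ = {e | ¬ e.IsDiag ∧ ∀ v ∈ e, v ∈ W}` the complete graph on `W`;
`P, Q ∈ W` (`Q = P` allowed); arms `u 0 = P, …, u a = y` and `w 0 = Q, …, w b = z` of vertices outside `W` (fresh), `x` fresh joined to
`y, z`, `yz ∉ H = E₀ ∪ arms`, `E = H + xy + xz`.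
* `Antithetic.Complete.handle_vertex_sum_nonneg` — **THEOREM KnH**: for all monotone `F, G`,
  `0 ≤ Σ_{ω : ¬(x ∈ X_E ω ∧ x ∈ Y_E ω)} (F(X_E ω) − F(Y_E ω))·(G(X_E ω) − G(Y_E ω))`.
PROOF = DUAL HANDLE THEOREM (…AntitheticHandleDual) with (⊕) = `Antithetic.Complete.oplus_nonneg` (…AntitheticComparable: in a 2-coloured
complete graph the red and blue clusters of `s` are comparable, which yields a two-piece certificate) and (M) = `Antithetic.Apex.mixed_nonneg`
(every vertex of a complete graph is an apex).  Supersedes the certificate-based …AntitheticK4Handle / …K5Handle (`n = 4, 5`) as a family.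
[cite: VandenbergHaggstromKahn2005, §1 p. 6 ("Harris' inequality"), §1 p. 3 (open cluster `C_s`)]
-/

noncomputable section

namespace Summit.CriticalPhenomena.PercolationContinuityZ3.Theorems

open Literature.Probability.Percolation
open scoped Classical

namespace Antithetic

namespace Complete

variable {V : Type*} [Fintype V] {W : Set V} {s P Q : V} (hs : s ∈ W) (hQ : Q ∈ W) {E₀ : Set (Sym2 V)}
  (hE₀ : E₀ = {e | ¬ e.IsDiag ∧ ∀ v ∈ e, v ∈ W})
  {u w : ℕ → V} {a b : ℕ} (hu0 : u 0 = P) (hw0 : w 0 = Q)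
  (hufresh : ∀ i, 0 < i → i ≤ a → ∀ f ∈ E₀ ∪ Cyc.edgeSet b w, u i ∈ f → f.IsDiag)
  (hwfresh : ∀ i, 0 < i → i ≤ b → ∀ f ∈ E₀, w i ∈ f → f.IsDiag)
  (huinj : ∀ i j, i ≤ a → j ≤ a → u i = u j → i = j) (hwinj : ∀ i j, i ≤ b → j ≤ b → w i = w j → i = j)
  (hsu : ∀ i, 0 < i → i ≤ a → s ≠ u i) (hsw : ∀ i, 0 < i → i ≤ b → s ≠ w i)
  (hPw : ∀ i, 0 < i → i ≤ b → P ≠ w i) (hzu : ∀ i, 0 < i → i ≤ a → w b ≠ u i)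
include hs hQ hE₀ hu0 hw0 hufresh hwfresh huinj hwinj hsu hsw hPw hzu

/-- **THEOREM KnH (complete graph + handle, every size, all arm lengths).**  With the notation of the module docstring, for all monotone
`F, G`: `0 ≤ Σ_{ω : ¬(x ∈ X_E ω ∧ x ∈ Y_E ω)} (F(X_E ω) − F(Y_E ω))·(G(X_E ω) − G(Y_E ω))` (`H` written `E₀ ∪ (arm ∪ stub)`). [this work] -/
theorem handle_vertex_sum_nonneg {x : V}
    (hx : ∀ f ∈ E₀ ∪ (Cyc.edgeSet a u ∪ Cyc.edgeSet b w), x ∈ f → f.IsDiag)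
    (hxs : x ≠ s) (hxy : x ≠ u a) (hxz : x ≠ w b) (hyz : u a ≠ w b) (hg : s(u a, w b) ∉ E₀ ∪ (Cyc.edgeSet a u ∪ Cyc.edgeSet b w))
    {F G : Set V → ℝ} (hF : Monotone F) (hG : Monotone G) :
    0 ≤ ∑ ω ∈ Finset.univ.filter (fun ω : Set (Sym2 V) =>
        ¬ ((openGraph (ω ∩ insert s(x, u a) (insert s(x, w b) (E₀ ∪ (Cyc.edgeSet a u ∪ Cyc.edgeSet b w))))).Reachable s x ∧
          (openGraph (ωᶜ ∩ insert s(x, u a) (insert s(x, w b) (E₀ ∪ (Cyc.edgeSet a u ∪ Cyc.edgeSet b w))))).Reachable s x)),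
      (F (openCluster (ω ∩ insert s(x, u a) (insert s(x, w b) (E₀ ∪ (Cyc.edgeSet a u ∪ Cyc.edgeSet b w)))) s) -
          F (openCluster (ωᶜ ∩ insert s(x, u a) (insert s(x, w b) (E₀ ∪ (Cyc.edgeSet a u ∪ Cyc.edgeSet b w)))) s)) *
        (G (openCluster (ω ∩ insert s(x, u a) (insert s(x, w b) (E₀ ∪ (Cyc.edgeSet a u ∪ Cyc.edgeSet b w)))) s) -
          G (openCluster (ωᶜ ∩ insert s(x, u a) (insert s(x, w b) (E₀ ∪ (Cyc.edgeSet a u ∪ Cyc.edgeSet b w)))) s)) := by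
  -- (edge set `E₀ ∪ (arm ∪ stub)`; the dual handle theorem writes `arm ∪ (E₀ ∪ stub)`)
  have hcomm : E₀ ∪ (Cyc.edgeSet a u ∪ Cyc.edgeSet b w) = Cyc.edgeSet a u ∪ (E₀ ∪ Cyc.edgeSet b w) := Set.union_left_comm _ _ _
  rw [hcomm] at hx hg ⊢
  have hnd : ∀ f ∈ E₀, ¬ f.IsDiag := fun f hf => by rw [hE₀] at hf; exact hf.1
  -- (⊕): complete graphs are ⊕-positive (comparability)
  have hop := fun (K₁ K₂ : Set V → Set V → ℝ) hK₁ hso₁ hK₂ hso₂ => oplus_nonneg hs hE₀ P K₁ K₂ hK₁ hso₁ hK₂ hso₂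
  -- (M): `Q ∈ W` is an apex of the complete graph
  have hapex : ∀ e ∈ E₀, ∀ v ∈ e, v ≠ Q → s(v, Q) ∈ E₀ := by
    intro e he v hv hvQ
    rw [hE₀] at he ⊢
    refine ⟨by rw [Sym2.mk_isDiag_iff]; exact hvQ, fun t ht => ?_⟩
    rcases Sym2.mem_iff.1 ht with rfl | rfl
    · exact he.2 _ hv
    · exact hQ
  have hmix := fun (K₁ K₂ : Set V → Set V → ℝ) hK₁ hso₁ hK₂ hso₂ =>
    Apex.mixed_nonneg (E := E₀) (s := s) hapex P K₁ K₂ hK₁ hso₁ hK₂ hso₂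
  have h := Pendant.handle_vertex_sum_nonneg_of_oplus hnd hwfresh hwinj hsw hPw hop hu0 hw0 hufresh huinj hsu hzu hmix
    hx hxs hxy hxz hyz hg hF hG
  -- (`Decidable` instances of the event differ between the imported files; `convert` identifies them)
  convert h using 3

end Complete

end Antithetic

end Summit.CriticalPhenomena.PercolationContinuityZ3.Theorems
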